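import Mathlib
import Summits.NavierStokesRegularity.NavierStokesRegularity.Theorems.BarrierStepRungThreeSOSPolyCalculus
import HarnessLib

/-!
# `BarrierStepRungThree`, LINE g2-2: scaling / homogeneous decomposition of `SOS.Poly` clocks
(the re-entry clause in `sdp2lean` currency)

The GOAL clause of the window certificate evaluates the clock at the RESCALED shifted state `y / a`;
`CertificateProfile.reentry_of_homogeneous` (Theorems/BarrierStepRungThreeReentryScaling.lean) turns
this into polynomial inequalities once the certificate writer supplies a homogeneous decomposition
`v (t • x) = Σ_{m ≤ d} t^m · v_m x`. For clocks given as sparse rational polynomials composed with a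
linear coordinate map, `v x = P.eval (L x)`, this file supplies that decomposition with NO new
definition: the degree-`m` part of `P` is the sub-list `P.filter (·.1.sum = m)`, and

* `monomial_eval_smul` : `m.eval (t • y) = t^{|m|} · m.eval y`;
* `eval_smul_eq_sum_filter` : `P.eval (t • y) = Σ_{m ≤ d} t^m · (P.filter (deg = m)).eval y`
  whenever every term of `P` has degree `≤ d`;
* `eval_comp_smul_eq_sum_filter` : the same for `v = P.eval ∘ L`, in the shape
  `v (t • x) = Σ_{m ∈ range (d+1)} t^m · v_m x` with `v_m := (P.filter (deg = m)).eval ∘ L`.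

HONEST FRAMING: elementary algebra for the certificate FORMAT (MODEL lattice, class rung TL-M3);
proves no certificate and nothing about the Navier–Stokes equations.
-/

noncomputable section

-- the sub-problem namespace `Summit.NavierStokesRegularity.NavierStokesRegularity` repeats the summit name by design (D-0017)
set_option linter.dupNamespace false

namespace Summit.NavierStokesRegularity.NavierStokesRegularity.Theorems

namespace SOSPolyCalculus

open Finset
open Literature.Computation.Certificates Literature.Computation.Certificates.SOS
open Literature.Computation.Certificates.SOS.Poly Literature.Computation.Certificates.SOS.Monomial

/-- Scaling a point scales a monomial read from index `k₀` by `t^(sum of the exponents)`. [folklore] -/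
theorem monomial_evalFrom_smul (t : ℝ) (y : ℕ → ℝ) :
    ∀ (m : Monomial) (k₀ : ℕ),
      (Monomial.evalFrom (fun k => t * y k) k₀ m : ℝ) = t ^ m.sum * Monomial.evalFrom y k₀ m
  | [], _ => by simp
  | e :: es, k₀ => by
      rw [evalFrom_cons, evalFrom_cons, monomial_evalFrom_smul t y es (k₀ + 1), List.sum_cons, pow_add,
        mul_pow]
      ring

/-- `m.eval (t • y) = t^{|m|} · m.eval y`. [folklore] -/
theorem monomial_eval_smul (t : ℝ) (y : ℕ → ℝ) (m : Monomial) :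
    (Monomial.eval (fun k => t * y k) m : ℝ) = t ^ m.sum * Monomial.eval y m := by
  simpa using monomial_evalFrom_smul t y m 0

/-- **Homogeneous decomposition of a sparse polynomial under scaling.** If every term of `P` has
total degree `≤ d`, then `P(t • y) = Σ_{m ≤ d} t^m · P_m(y)` with `P_m := P.filter (deg = m)` (a
sub-list, no new definition). [folklore] -/
theorem eval_smul_eq_sum_filter (t : ℝ) (y : ℕ → ℝ) (d : ℕ) :
    ∀ P : Poly, (∀ mc ∈ P, mc.1.sum ≤ d) →
      (Poly.eval (fun k => t * y k) P : ℝ) =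
        ∑ m ∈ range (d + 1), t ^ m * Poly.eval y (P.filter fun mc => decide (mc.1.sum = m))
  | [], _ => by simp
  | (mo, c) :: P, hP => by
      have hmo : mo.sum ≤ d := hP (mo, c) (by simp)
      have hP' : ∀ mc ∈ P, mc.1.sum ≤ d := fun mc hmc => hP mc (by simp [hmc])
      rw [Poly.eval_cons, monomial_eval_smul, eval_smul_eq_sum_filter t y d P hP']
      -- the new term lands in the degree-`mo.sum` summand
      have hsplit : ∀ m ∈ range (d + 1),
          (Poly.eval y (((mo, c) :: P).filter fun mc => decide (mc.1.sum = m)) : ℝ) =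
            (if mo.sum = m then (c : ℝ) * Monomial.eval y mo else 0) +
              Poly.eval y (P.filter fun mc => decide (mc.1.sum = m)) := by
        intro m _
        rw [List.filter_cons]
        by_cases h : mo.sum = m
        · simp [h]
        · simp [h]
      have hR : (∑ m ∈ range (d + 1), t ^ m *
            Poly.eval y (((mo, c) :: P).filter fun mc => decide (mc.1.sum = m)) : ℝ) =
          ∑ m ∈ range (d + 1), ((if mo.sum = m then t ^ m * ((c : ℝ) * Monomial.eval y mo) else 0) +
            t ^ m * Poly.eval y (P.filter fun mc => decide (mc.1.sum = m))) :=
        sum_congr rfl fun m hm => by rw [hsplit m hm, mul_add, mul_ite, mul_zero]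
      rw [hR, sum_add_distrib]
      rw [Finset.sum_ite_eq (range (d + 1)) mo.sum (fun m => t ^ m * ((c : ℝ) * Monomial.eval y mo)),
        if_pos (by simpa [Nat.lt_succ_iff] using hmo)]
      ring

/-- **The template's homogeneous decomposition for `v = P ∘ L`.** With `v_m x := P_m.eval (L x)`
(`P_m` the degree-`m` sub-list), `v (t • x) = Σ_{m ∈ range (d+1)} t^m · v_m x`. [folklore] -/
theorem eval_comp_smul_eq_sum_filter {E : Type*} [NormedAddCommGroup E] [NormedSpace ℝ E]
    (L : E →L[ℝ] (ℕ → ℝ)) (P : Poly) (d : ℕ) (hP : ∀ mc ∈ P, mc.1.sum ≤ d) (t : ℝ) (x : E) :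
    (Poly.eval (L (t • x)) P : ℝ) =
      ∑ m ∈ range (d + 1), t ^ m * Poly.eval (L x) (P.filter fun mc => decide (mc.1.sum = m)) := by
  have hL : L (t • x) = fun k => t * L x k := by
    ext k
    simp [map_smul]
  rw [hL]
  exact eval_smul_eq_sum_filter t (L x) d P hP

end SOSPolyCalculus

end Summit.NavierStokesRegularity.NavierStokesRegularity.Theorems
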